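import Mathlib
import Literature.NumberTheory.GaloisRepresentations.UnitsHerbrand
import Summits.QuantumAdvantage.QuantumAdvantage.Theorems.LinnikCubicClassGroupsPureCubicClassNumberHardGenusSetup

/-!
# Crux `LinnikCubicClassGroups.PureCubicClassNumberHard` (stmt-QuantumAdvantage-11826) —
# genus theory for `N = ℚ(ζ₃, ∛(pq)) / ℚ(ζ₃)`, part 2: the unit index `#H¹(σ, 𝓞_Nˣ) ≥ 9`

Line `Sketch` (honda-leak arm), towards the lead's stub `stub_ambiguousTrivial` (`3 ∤ h_N`).
In the setting of part 1 (`…GenusSetup`: Galois number field `N` of degree `6`, `ζ² + ζ + 1 = 0`,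
`σ ≠ 1` fixing `ζ`, `F = ℚ(ζ)`, `Gal(N/F) = ⟨σ⟩`), assume moreover that `ζ` is not a norm from `N`
(`hnorm`, the landed `stub_normNeZeta`).  Then:

* `genus_archFactor_eq_one` — `F` is totally complex, so the archimedean Herbrand factor is `1`;
* `genus_norm_unit` — the norm `u · σu · σ²u` of a unit of `𝓞 N` is `±1` (a `σ`-fixed unit is
  `±ζ^r`, and `r ≠ 0` would make `±ζ^{±1}` a norm);
* `genus_nine_le_h1` — **`#H¹(Gal(N/F), 𝓞_Nˣ) ≥ 9`**: the tree's unit Herbrand quotient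
  (`MinkowskiUnit.card_mul_h0_unitsE_eq`, Childress Prop. 5.10: `3 · #Ĥ⁰ = 2^a · #H¹`) with
  `2^a = 1`, and `3 ∣ #Ĥ⁰ = [fixed units : norms]` from the chain
  `norms ≤ ⟨-1⟩ ≤ ⟨-ζ⟩ ≤ fixed units`, `[⟨-ζ⟩ : ⟨-1⟩] = 3`.
-/

set_option linter.dupNamespace false -- D-0017 (Summits/<S>/<S>/… by design)

namespace Summit.QuantumAdvantage.QuantumAdvantage.Theorems.LinnikCubicClassGroups

open NumberField IsDedekindDomain
open scoped IntermediateField nonZeroDivisors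

variable {N : Type} [Field N] [NumberField N] [IsGalois ℚ N]

/-! ## Part 2: the unit index `#H¹(σ, E_N) ≥ 9` -/

section Units

open Literature.NumberTheory.GaloisRepresentations
open Literature.NumberTheory.GaloisRepresentations.MinkowskiUnit

omit [IsGalois ℚ N] in
/-- `ℚ(ζ)` has no real place. [folklore] -/
theorem genus_not_isReal {ζ : N} (hζ : IsPrimitiveRoot ζ 3) (v : NumberField.InfinitePlace ℚ⟮ζ⟯) :
    ¬ v.IsReal := by
  classical
  haveI := genus_isCyclotomicExtension hζ
  have h0 : NumberField.InfinitePlace.nrRealPlaces ℚ⟮ζ⟯ = 0 :=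
    IsCyclotomicExtension.Rat.nrRealPlaces_eq_zero (n := 3) ℚ⟮ζ⟯ (by norm_num)
  intro hv
  have : 0 < NumberField.InfinitePlace.nrRealPlaces ℚ⟮ζ⟯ := by
    rw [NumberField.InfinitePlace.nrRealPlaces, Fintype.card_pos_iff]
    exact ⟨⟨v, hv⟩⟩
  omega

/-- The archimedean Herbrand factor of `N/ℚ(ζ)` is `1` (no real place of `ℚ(ζ)` to ramify).
[folklore] -/
theorem genus_archFactor_eq_one {ζ : N} (hζ : IsPrimitiveRoot ζ 3) :
    ArchHerbrand.archFactor ℚ⟮ζ⟯ N = 1 := by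
  unfold ArchHerbrand.archFactor
  refine Finset.prod_eq_one fun v _ => ?_
  rw [← NumberField.InfinitePlace.isUnramified_iff_card_stabilizer_eq_one]
  by_contra h
  rw [NumberField.InfinitePlace.not_isUnramified_iff] at h
  exact genus_not_isReal hζ _ h.2

/-- **The norm of a unit of `𝓞 N` is `±1`**: it is a `σ`-fixed unit, hence `±ζ^r`, and `r ≠ 0` is
excluded because `ζ` is not a norm. [folklore] -/
theorem genus_norm_unit (hN : Module.finrank ℚ N = 6) {ζ : N} (hζ : ζ ^ 2 + ζ + 1 = 0)
    {σ : N ≃ₐ[ℚ] N} (hσζ : σ ζ = ζ) (hσ1 : σ ≠ 1) (hnorm : ∀ x : N, x * σ x * σ (σ x) ≠ ζ)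
    (u : (𝓞 N)ˣ) :
    ((u : 𝓞 N) : N) * σ ((u : 𝓞 N) : N) * σ (σ ((u : 𝓞 N) : N)) = 1 ∨
      ((u : 𝓞 N) : N) * σ ((u : 𝓞 N) : N) * σ (σ ((u : 𝓞 N) : N)) = -1 := by
  have hζ' := genus_isPrimitiveRoot hζ
  set x : N := ((u : 𝓞 N) : N) with hxdef
  set n : N := x * σ x * σ (σ x) with hndef
  -- `n` is a `σ`-fixed unit value
  have hx0 : x ≠ 0 := by
    rw [hxdef]; exact_mod_cast (Units.ne_zero u)
  have hn0 : n ≠ 0 := by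
    rw [hndef]
    exact mul_ne_zero (mul_ne_zero hx0 ((map_ne_zero σ).mpr hx0))
      ((map_ne_zero σ).mpr ((map_ne_zero σ).mpr hx0))
  have hxint : IsIntegral ℤ x := (u : 𝓞 N).2
  have hσint : ∀ y : N, IsIntegral ℤ y → IsIntegral ℤ (σ y) := fun y hy =>
    IsIntegral.map (σ.toAlgHom.restrictScalars ℤ) hy
  have hnint : IsIntegral ℤ n :=
    (hxint.mul (hσint x hxint)).mul (hσint _ (hσint x hxint))
  have hxinv : IsIntegral ℤ x⁻¹ := by
    have hmul : x * ((↑(u⁻¹ : (𝓞 N)ˣ) : 𝓞 N) : N) = 1 := by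
      have h := congrArg (fun z : 𝓞 N => (z : N)) u.mul_inv
      push_cast at h
      exact h
    rw [← eq_inv_of_mul_eq_one_right hmul]
    exact (↑(u⁻¹ : (𝓞 N)ˣ) : 𝓞 N).2
  have hninv : IsIntegral ℤ n⁻¹ := by
    have : n⁻¹ = x⁻¹ * σ x⁻¹ * σ (σ x⁻¹) := by
      rw [hndef]; simp only [map_inv₀, mul_inv]
    rw [this]
    exact (hxinv.mul (hσint _ hxinv)).mul (hσint _ (hσint _ hxinv))
  have hσn : σ n = n := by
    rw [hndef, map_mul, map_mul, genus_apply_apply_apply hN hζ' hσζ x]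
    ring
  obtain ⟨r, hr, hnr⟩ := genus_fixed_unit hN hζ' hσζ hσ1 hn0 hnint hninv hσn
  obtain ⟨h2, hm1, hm2⟩ := genus_norm_ne_of_ne_zeta hζ σ hnorm x
  interval_cases r
  · simpa using hnr
  · rw [pow_one] at hnr
    rcases hnr with h | h
    · exact absurd h (hnorm x)
    · exact absurd h hm1
  · rcases hnr with h | h
    · exact absurd h h2
    · exact absurd h hm2


/-- The value of the Herbrand norm of a unit `a ∈ Nˣ` for `Gal(N/ℚ(ζ)) = ⟨τ⟩`, `τ = σ`:
`N(a) = a · σa · σ²a`. [folklore] -/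
theorem genus_val_herbrandNorm (hN : Module.finrank ℚ N = 6) {ζ : N} (hζ : IsPrimitiveRoot ζ 3)
    {σ : N ≃ₐ[ℚ] N} (hσζ : σ ζ = ζ) (hσ1 : σ ≠ 1) (a : Nˣ) :
    ((Herbrand.norm (N ≃ₐ[ℚ⟮ζ⟯] N) a : Nˣ) : N) = (a : N) * σ (a : N) * σ (σ (a : N)) := by
  rw [Herbrand.norm_apply, Units.coe_prod]
  simp_rw [val_smul]
  rw [← Algebra.norm_eq_prod_automorphisms, genus_norm_eq hN hζ hσζ hσ1]

/-- **The unit index: `#H¹(Gal(N/ℚ(ζ)), 𝓞_Nˣ) ≥ 9`.**  By the tree's unit Herbrand quotient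
(`MinkowskiUnit.card_mul_h0_unitsE_eq`, Childress Prop. 5.10) `3 · #Ĥ⁰ = 2^a · #H¹` with `2^a = 1`
(`ℚ(ζ)` is totally complex); and `3 ∣ #Ĥ⁰ = [fixed units : norms of units]` because the norms of
units lie in `{±1}` (`genus_norm_unit`) which has index `3` in the fixed subgroup `μ₆ = ⟨-ζ⟩`.
[folklore] -/
theorem genus_nine_le_h1 (hN : Module.finrank ℚ N = 6) {ζ : N} (hζ : ζ ^ 2 + ζ + 1 = 0)
    {σ : N ≃ₐ[ℚ] N} (hσζ : σ ζ = ζ) (hσ1 : σ ≠ 1) (hnorm : ∀ x : N, x * σ x * σ (σ x) ≠ ζ)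
    {τ : N ≃ₐ[ℚ⟮ζ⟯] N} (hτσ : ∀ x : N, τ x = σ x) (hτ : ∀ g : N ≃ₐ[ℚ⟮ζ⟯] N, g ∈ Subgroup.zpowers τ) :
    9 ≤ Herbrand.h1 τ (unitsE N) ⊥ := by
  classical
  have hζ' := genus_isPrimitiveRoot hζ
  have h3 := genus_zeta_pow_three hζ
  obtain ⟨heq, hne⟩ := card_mul_h0_unitsE_eq (F := ℚ⟮ζ⟯) (E := N) hτ
  have hcard : Fintype.card (N ≃ₐ[ℚ⟮ζ⟯] N) = 3 := by
    rw [← Nat.card_eq_fintype_card, IsGalois.card_aut_eq_finrank, genus_finrank_top hN hζ']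
  rw [hcard, genus_archFactor_eq_one hζ', one_mul] at heq
  -- it remains to see `3 ∣ h0`
  suffices hdvd : 3 ∣ Herbrand.h0 τ (unitsE N) ⊥ by
    obtain ⟨k, hk⟩ := hdvd
    have h9 : 9 ∣ Herbrand.h1 τ (unitsE N) ⊥ := ⟨k, by rw [← heq, hk]; ring⟩
    exact Nat.le_of_dvd (Nat.pos_of_ne_zero hne) h9
  -- the chain `b0 ≤ T = ⟨-1⟩ ≤ M6 = ⟨-ζ⟩ ≤ z0`
  set A : Subgroup Nˣ := unitsE N with hA
  have hζ0 : (-ζ : N) ≠ 0 := neg_ne_zero.mpr (genus_zeta_ne_zero hζ)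
  set u₀ : Nˣ := Units.mk0 (-ζ) hζ0 with hu₀
  set T : Subgroup Nˣ := Subgroup.zpowers (-1 : Nˣ) with hT
  set M6 : Subgroup Nˣ := Subgroup.zpowers u₀ with hM6
  -- `b0 ≤ T`: norms of units are `±1`
  have hbT : Herbrand.b0 (N ≃ₐ[ℚ⟮ζ⟯] N) A ⊥ ≤ T := by
    intro y hy
    rw [Herbrand.b0_bot] at hy
    obtain ⟨a, ha, rfl⟩ := hy
    obtain ⟨u, rfl⟩ := (mem_unitsE_iff).mp ha
    have hval := genus_val_herbrandNorm hN hζ' hσζ hσ1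
      (Units.map (algebraMap (𝓞 N) N : 𝓞 N →* N) u)
    rw [val_unitsMap] at hval
    rcases genus_norm_unit hN hζ hσζ hσ1 hnorm u with h | h
    · have : Herbrand.norm (N ≃ₐ[ℚ⟮ζ⟯] N) (Units.map (algebraMap (𝓞 N) N : 𝓞 N →* N) u) = 1 :=
        Units.ext (by rw [hval, h, Units.val_one])
      rw [this]; exact one_mem _
    · have : Herbrand.norm (N ≃ₐ[ℚ⟮ζ⟯] N) (Units.map (algebraMap (𝓞 N) N : 𝓞 N →* N) u) = -1 :=
        Units.ext (by rw [hval, h, Units.val_neg, Units.val_one])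
      rw [this]; exact Subgroup.mem_zpowers _
  -- `T ≤ M6`: `-1 = (-ζ)³`
  have hu3 : u₀ ^ 3 = -1 := Units.ext (by
    rw [Units.val_pow_eq_pow_val, hu₀, Units.val_mk0, Units.val_neg, Units.val_one, neg_pow, h3]
    norm_num)
  have hTM : T ≤ M6 := by
    rw [hT, Subgroup.zpowers_le, ← hu3]
    exact Subgroup.pow_mem _ (Subgroup.mem_zpowers _) 3
  -- `M6 ≤ z0`: `-ζ` is a `τ`-fixed global unit
  have hζint : IsIntegral ℤ ζ := (hζ'.isIntegral (by norm_num))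
  set a0 : 𝓞 N := ⟨-ζ, hζint.neg⟩ with ha0
  set b0' : 𝓞 N := ⟨-ζ ^ 2, (hζint.pow 2).neg⟩ with hb0'
  have hab : a0 * b0' = 1 := by
    apply RingOfIntegers.coe_injective
    change (-ζ) * (-ζ ^ 2) = 1
    calc (-ζ) * (-ζ ^ 2) = ζ ^ 3 := by ring
      _ = 1 := h3
  have hu₀A : u₀ ∈ A := by
    refine (mem_unitsE_iff).mpr ⟨Units.mkOfMulEqOne a0 b0' hab, Units.ext ?_⟩
    rw [val_unitsMap, Units.val_mkOfMulEqOne, hu₀, Units.val_mk0]; rfl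
  have hτu₀ : τ • u₀ = u₀ := Units.ext (by
    rw [val_smul, hu₀, Units.val_mk0, map_neg, hτσ, hσζ])
  have hMz : M6 ≤ Herbrand.z0 τ A ⊥ := by
    rw [hM6, Subgroup.zpowers_le, Herbrand.mem_z0_bot]
    exact ⟨hu₀A, hτu₀⟩
  -- `[M6 : T] = 3`
  have hcardT : Nat.card T = 2 := by
    rw [hT, Nat.card_zpowers]
    haveI : Fact (Nat.Prime 2) := ⟨Nat.prime_two⟩
    refine orderOf_eq_prime (by rw [neg_one_sq]) ?_
    intro h
    have h' : ((-1 : Nˣ) : N) = 1 := by rw [h, Units.val_one]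
    rw [Units.val_neg, Units.val_one] at h'
    norm_num at h'
  have hcardM : Nat.card M6 = 6 := by
    rw [hM6, Nat.card_zpowers]
    refine orderOf_eq_of_pow_and_pow_div_prime (by norm_num) ?_ ?_
    · rw [show (6 : ℕ) = 3 * 2 from rfl, pow_mul, hu3, neg_one_sq]
    · intro r hr hr6
      have hr' : r = 2 ∨ r = 3 := by
        have := (Nat.le_of_dvd (by norm_num) hr6)
        interval_cases r <;> simp_all (config := {decide := true})
      rcases hr' with rfl | rfl
      · -- `u₀ ^ 3 ≠ 1`
        rw [show (6 : ℕ) / 2 = 3 from rfl, hu3]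
        intro h
        have h' : ((-1 : Nˣ) : N) = 1 := by rw [h, Units.val_one]
        rw [Units.val_neg, Units.val_one] at h'
        norm_num at h'
      · -- `u₀ ^ 2 ≠ 1`
        rw [show (6 : ℕ) / 3 = 2 from rfl]
        intro h
        have h' : ((u₀ ^ 2 : Nˣ) : N) = 1 := by rw [h, Units.val_one]
        rw [Units.val_pow_eq_pow_val, hu₀, Units.val_mk0, neg_sq] at h'
        exact (hζ'.pow_ne_one_of_pos_of_lt (by norm_num) (by norm_num)) h'
  have hrelTM : T.relIndex M6 = 3 := by
    have h := Subgroup.relIndex_mul_relIndex ⊥ T M6 bot_le hTM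
    rw [Subgroup.relIndex_bot_left, Subgroup.relIndex_bot_left, hcardT, hcardM] at h
    omega
  -- assemble `h0 = [z0 : b0] = [T : b0] · 3 · [z0 : M6]`
  have h0eq : Herbrand.h0 τ A ⊥ =
      (Herbrand.b0 (N ≃ₐ[ℚ⟮ζ⟯] N) A ⊥).relIndex T * (3 * M6.relIndex (Herbrand.z0 τ A ⊥)) := by
    rw [Herbrand.h0_def, ← Subgroup.relIndex_mul_relIndex _ _ _ hbT (hTM.trans hMz),
      ← Subgroup.relIndex_mul_relIndex _ _ _ hTM hMz, hrelTM]
  exact ⟨(Herbrand.b0 (N ≃ₐ[ℚ⟮ζ⟯] N) A ⊥).relIndex T * M6.relIndex (Herbrand.z0 τ A ⊥),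
    by rw [h0eq]; ring⟩

/-- **The unit index `#H¹ ≥ 9`, explicit form** (registered anchor of this helper file).
[folklore] -/
theorem genus_nine_le_h1_explicit (N : Type) [Field N] [NumberField N] [IsGalois ℚ N]
    (hN : Module.finrank ℚ N = 6) (ζ : N) (hζ : ζ ^ 2 + ζ + 1 = 0) (σ : N ≃ₐ[ℚ] N)
    (hσζ : σ ζ = ζ) (hσ1 : σ ≠ 1) (hnorm : ∀ x : N, x * σ x * σ (σ x) ≠ ζ)
    (τ : N ≃ₐ[ℚ⟮ζ⟯] N) (hτσ : ∀ x : N, τ x = σ x)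
    (hτ : ∀ g : N ≃ₐ[ℚ⟮ζ⟯] N, g ∈ Subgroup.zpowers τ) :
    9 ≤ Herbrand.h1 τ (unitsE N) ⊥ :=
  genus_nine_le_h1 hN hζ hσζ hσ1 hnorm hτσ hτ

end Units

end Summit.QuantumAdvantage.QuantumAdvantage.Theorems.LinnikCubicClassGroups
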